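import Summits.BirchSwinnertonDyer.BirchSwinnertonDyer.Theorems.ManinLocalTwoThreeEtaIdentityReductionTwentyFour
import Literature.NumberTheory.EllipticCurves.DegeneracyTraceCosetSum
import Literature.NumberTheory.EllipticCurves.NewformsLevelLowering
import Literature.NumberTheory.EllipticCurves.ModularCurveEtaQuotientLogPeriod
import HarnessLib

/-!
# Level 48 (`4 ∣ 48`, genus `g(X₀(48)) = 3`), part 1: `φ₄₈ = η(4τ)⁴η(12τ)⁴/(η(2τ)η(6τ)η(8τ)η(24τ))` is killed by
# both adjoint degeneracy maps to level `24` — FACT-FREE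

Cell bsd-f2-manin, route `ManinLocalTwoThree` (crux C2 `ManinOddAtFour`, stmt-22967: `2² ∣ 48`), prover seat p2 gen 26.
The five genus-one levels `20, 24, 27, 32, 36` of the C2/C3 domains are settled fact-free (`|c| = 1`); there the newform
is pinned by `dim S₂(Γ₀(N)) = 1`.  At `N = 48`, `dim S₂(Γ₀(48)) = g(X₀(48)) = 3` (`= ℂf₂₄ ⊕ ℂf₂₄|diag(2,1) ⊕ ℂφ₄₈`), and
the newform has to be separated from the old forms.  This file does the analytic half:

* §1 `φ₄₈ = η₄⁴η₁₂⁴/(η₂η₆η₈η₂₄) = q + q³ − 2q⁵ + q⁹ − 4q¹¹ − ⋯ ∈ S₂(Γ₀(48))` (Ligozat certificate), `a₁(φ₄₈) = 1`.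
* §2 `U₂ φ₄₈ = 0` (`φ₄₈` is `q` times a series in `q²`; the half-shift `z ↦ z + ½` negates it), i.e. the adjoint
  degeneracy map `S₂(Γ₀(48)) → S₂(Γ₀(24))` at `d = 2` kills `φ₄₈` (tree `coe_adjDegeneracyMap0_of_sq_dvd`).
* §3 The trace `S₂(Γ₀(48)) → S₂(Γ₀(24))` (adjoint degeneracy map at `d = 1`, tree `coe_adjDegeneracyMap0_one_eq_sum`:
  `φ ↦ φ + φ|W`, `W = ᵀ(T²⁴) = (1 0; 24 1)`) kills `φ₄₈`: `φ₄₈ = u·f₂₄` with the weight-`0` quotient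
  `u = η₄³η₁₂³/(η₂²η₆²η₈η₂₄)`; Dedekind's functional equation factor by factor (tree
  `etaQuotient_smul_eq_cexp_sum_rademacherPhi`, with `Φ(1,0;c,1) = 3 − c` from the Dedekind sums `s(1,c)`, `c ∣ 24`)
  gives the general law `g(Wτ) = e^{−(πi/12)Σ(24/δ)r_δ} g(τ)` for weight-`0` `η`-quotients of level `24`, so
  `u∘W = −u`, `φ₄₈(Wτ) = −(24τ+1)²φ₄₈(τ)`, `φ₄₈|W = −φ₄₈`, `φ₄₈ + φ₄₈|W = 0`.

The sequel `…NewformPinningFortyEight` concludes: `φ₄₈` is new, `S₂(Γ₀(48))^{new} = ℂφ₄₈`, and `D.f = φ₄₈` for every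
`X₀(48)`-datum.  No definition (the form is carried as `φ` with `⇑φ = etaQuotient 48 …`), no named fact, no sorry.
Nothing here proves C2, Manin's conjecture or BSD. [cite: Ligozat1975, Ch. 3] [cite: AtkinLehner1970, Lemma 7, Thm. 5]
[cite: DiamondShurman2005, §5.1] [cite: Apostol1990, Thm. 3.4] [cite: RademacherGrosswald1972, Ch. 4 A] [cite: CremonaAlgorithms1997, Table 3 (N = 48)]
-/

set_option autoImplicit false
-- lint-debt: the directory name repeats the summit name (sibling precedent `ManinLocalTwoThreeEtaIdentityReductionTwentyFour.lean`)
set_option linter.dupNamespace false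

noncomputable section

open Complex Filter Topology Set Function Asymptotics
open UpperHalfPlane hiding I
open scoped Real Topology Manifold MatrixGroups ModularForm
open ModularForm CongruenceSubgroup Matrix.SpecialLinearGroup
open Literature.NumberTheory.ModularForms
open Literature.NumberTheory.EllipticCurves Literature.NumberTheory.EllipticCurves.ModularForms

namespace Summit.BirchSwinnertonDyer.BirchSwinnertonDyer.Theorems.ManinLocalTwoThree.NewformFortyEight

open CuspToolkit

/-! ## §1 `φ₄₈ = η₄⁴η₁₂⁴/(η₂η₆η₈η₂₄) ∈ S₂(Γ₀(48))` -/

/-- Ligozat/Newman certificate of `φ₄₈` (`Σδr = Σ(48/δ)r = 24`, `∏δ^{|r|} = 110592²`, positive order at all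
`12` cusps). [cite: Ligozat1975, Ch. 3] -/
theorem etaCert_fortyEight : EtaCert 48 [(2, -1), (4, 4), (6, -1), (8, -1), (12, 4), (24, -1)] 110592 := by
  decide

/-- Newman's conditions for `φ₄₈` in weight `2`. [folklore] -/
theorem newmanCond_phi48 : NewmanCond 48 (expFn [(2, -1), (4, 4), (6, -1), (8, -1), (12, 4), (24, -1)]) 2 :=
  newmanCond_of_etaCert etaCert_fortyEight

/-- **`φ₄₈` is a weight-`2` cusp form on `Γ₀(48)`** (as a term: `etaQuotientCuspForm`). [cite: Ligozat1975, Ch. 3] -/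
theorem exists_cuspForm_phi48 :
    ∃ φ : CuspForm (Gamma0 48) 2, ⇑φ = etaQuotient 48 (expFn [(2, -1), (4, 4), (6, -1), (8, -1), (12, 4), (24, -1)]) :=
  ⟨etaQuotientCuspForm 48 _ 2 (by decide) newmanCond_phi48 etaCert_fortyEight.2.2.2.2, rfl⟩

/-- `φ₄₈/q → 1` at `i∞`. [folklore] -/
theorem tendsto_phi48_div_qParam :
    Tendsto (fun τ : ℍ ↦ etaQuotient 48 (expFn [(2, -1), (4, 4), (6, -1), (8, -1), (12, 4), (24, -1)]) τ
      / Periodic.qParam 1 (τ : ℂ)) atImInfty (𝓝 1) := by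
  have h := tendsto_etaQuotient_div_qParam_zpow 48 (expFn [(2, -1), (4, 4), (6, -1), (8, -1), (12, 4), (24, -1)]) 1
    (by decide)
  simpa only [zpow_one] using h

section Phi

variable (φ : CuspForm (Gamma0 48) 2)
  (hφ : ⇑φ = etaQuotient 48 (expFn [(2, -1), (4, 4), (6, -1), (8, -1), (12, 4), (24, -1)]))
include hφ

/-- `φ₄₈ ≠ 0`. [folklore] -/
theorem phi48_ne_zero : φ ≠ 0 := by
  intro h
  have h1 := congrArg (fun f : CuspForm (Gamma0 48) 2 ↦ f UpperHalfPlane.I) h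
  simp only [CuspForm.zero_apply] at h1
  rw [hφ] at h1
  exact etaQuotient_ne_zero 48 _ _ h1

/-- `a₁(φ₄₈) = 1`. [cite: CremonaAlgorithms1997, Table 3 (N = 48)] -/
theorem cuspCoeff_one_phi48 : cuspCoeff φ 1 = 1 :=
  NonVacuityTwentySeven.cuspCoeff_one_eq_of_tendsto _ (by simpa only [hφ] using tendsto_phi48_div_qParam)

end Phi

/-! ## §2 `U₂ φ₄₈ = 0`: the half-shift negates `φ₄₈` -/

/-- **Half-shift of an `η`-quotient supported on even `δ`**: `∏ η(δ(z + ½))^{r_δ} = e^{2πi (Σ_δ (δ/2) r_δ)/24} ∏ η(δz)^{r_δ}`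
(`η(w + n) = e^{2πin/24}η(w)`). [cite: Koehler2011, §1] -/
theorem etaQuotientC_add_half (N : ℕ) (r : ℕ → ℤ) (h : ∀ t ∈ N.divisors, r t ≠ 0 → 2 ∣ t) (z : ℂ) :
    etaQuotientC N r (z + 1 / 2)
      = cexp (2 * π * I * ((∑ t ∈ N.divisors, ((t / 2 : ℕ) : ℤ) * r t : ℤ) : ℂ) / 24) * etaQuotientC N r z := by
  unfold etaQuotientC
  have hpt : ∀ t ∈ N.divisors, ModularForm.eta (t * (z + 1 / 2)) ^ r t
      = cexp (2 * π * I * ((((t / 2 : ℕ) : ℤ) * r t : ℤ) : ℂ) / 24) * ModularForm.eta (t * z) ^ r t := by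
    intro t ht
    by_cases hr : r t = 0
    · simp [hr]
    · obtain ⟨s, hs⟩ := h t ht hr
      have hts : t / 2 = s := by omega
      have harg : (t : ℂ) * (z + 1 / 2) = t * z + ((s : ℤ) : ℂ) := by
        rw [hs]; push_cast; ring
      rw [harg, eta_add_intCast, mul_zpow, ← Complex.exp_int_mul, hts]
      congr 2
      push_cast
      ring
  rw [Finset.prod_congr rfl hpt, Finset.prod_mul_distrib, ← Complex.exp_sum]
  congr 2
  rw [Int.cast_sum, Finset.mul_sum, Finset.sum_div]

/-- **`φ₄₈(z + ½) = −φ₄₈(z)`** (`Σ_δ (δ/2) r_δ = 12`). [cite: Koehler2011, §1] -/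
theorem etaQuotientC_phi48_add_half (z : ℂ) :
    etaQuotientC 48 (expFn [(2, -1), (4, 4), (6, -1), (8, -1), (12, 4), (24, -1)]) (z + 1 / 2)
      = -etaQuotientC 48 (expFn [(2, -1), (4, 4), (6, -1), (8, -1), (12, 4), (24, -1)]) z := by
  rw [etaQuotientC_add_half 48 _ (by decide) z]
  have hs : (∑ t ∈ Nat.divisors 48, ((t / 2 : ℕ) : ℤ) * expFn [(2, -1), (4, 4), (6, -1), (8, -1), (12, 4), (24, -1)] t
      : ℤ) = 12 := by decide
  rw [hs, show (2 * π * I * ((12 : ℤ) : ℂ) / 24 : ℂ) = π * I by push_cast; ring, Complex.exp_pi_mul_I]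
  ring

/-- **`U₂ φ₄₈ = 0`**, i.e. the adjoint degeneracy map `S₂(Γ₀(48)) → S₂(Γ₀(24))` at `d = 2` kills `φ₄₈`
(`= ½(φ₄₈(τ/2) + φ₄₈((τ+1)/2)) = 0`). [cite: AtkinLehner1970, Lemma 7] -/
theorem adjDegeneracyMap0_two_phi48 (φ : CuspForm (Gamma0 48) 2)
    (hφ : ⇑φ = etaQuotient 48 (expFn [(2, -1), (4, 4), (6, -1), (8, -1), (12, 4), (24, -1)])) :
    adjDegeneracyMap0 48 24 2 2 φ = 0 := by
  haveI : Fact (Nat.Prime 2) := ⟨Nat.prime_two⟩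
  have h := coe_adjDegeneracyMap0_of_sq_dvd (N := 48) (k := 2) Nat.prime_two (by norm_num) φ
  apply DFunLike.ext
  intro τ
  have hτ := congr_fun h τ
  rw [coe_heckeT_gamma0_eq_sum 48 2 2 Nat.prime_two φ, if_pos (by norm_num), add_zero, Finset.sum_apply,
    Fin.sum_univ_two, slash_tpB_apply, slash_tpB_apply, hφ] at hτ
  rw [CuspForm.zero_apply]
  refine hτ.trans ?_
  rw [etaQuotient, etaQuotient, coe_tpB_smul, coe_tpB_smul]
  have h1 : (((τ : ℂ) + ((((1 : Fin 2) : ℕ) : ℤ) : ℂ)) / ((2 : ℕ) : ℂ)) = (τ : ℂ) / 2 + 1 / 2 := by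
    simp only [Fin.val_one, Nat.cast_one, Int.cast_one, Nat.cast_ofNat]; ring
  have h0 : (((τ : ℂ) + ((((0 : Fin 2) : ℕ) : ℤ) : ℂ)) / ((2 : ℕ) : ℂ)) = (τ : ℂ) / 2 := by
    simp only [Fin.val_zero, Nat.cast_zero, Int.cast_zero, Nat.cast_ofNat]; ring
  rw [h1, h0, etaQuotientC_phi48_add_half]
  ring

/-! ## §3 The trace to level `24` kills `φ₄₈`: Dedekind sums and the `W = (1 0; 24 1)`-symmetry -/

/-- `s(1,1) = s(1,2) = 0`, `s(1,3) = 1/18`, `s(1,4) = 1/8`, `s(1,6) = 5/18`, `s(1,8) = 7/16`, `s(1,12) = 55/72`,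
`s(1,24) = 253/144` (`s(1,k) = (k−1)(k−2)/(12k)`). [cite: RademacherGrosswald1972, Ch. 1 eq. (1)] -/
theorem dedekindSum_one_values :
    dedekindSum 1 1 = 0 ∧ dedekindSum 1 2 = 0 ∧ dedekindSum 1 3 = 1 / 18 ∧ dedekindSum 1 4 = 1 / 8 ∧
      dedekindSum 1 6 = 5 / 18 ∧ dedekindSum 1 8 = 7 / 16 ∧ dedekindSum 1 12 = 55 / 72 ∧
      dedekindSum 1 24 = 253 / 144 := by
  refine ⟨?_, ?_, ?_, ?_, ?_, ?_, ?_, ?_⟩ <;>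
  · rw [dedekindSum_def]
    simp only [Finset.sum_range_succ, Finset.sum_range_zero]
    norm_num [dedekindSaw]

/-- `Φ(1, 0; c, 1) = 3 − c` for `c ∈ {1, 2, 3, 4, 6, 8, 12, 24}` (the divisors of `24`).
[cite: RademacherGrosswald1972, Ch. 4 A, eq. (59)] -/
theorem rademacherPhi_lower_values :
    rademacherPhi 1 0 1 1 = 2 ∧ rademacherPhi 1 0 2 1 = 1 ∧ rademacherPhi 1 0 3 1 = 0 ∧
      rademacherPhi 1 0 4 1 = -1 ∧ rademacherPhi 1 0 6 1 = -3 ∧ rademacherPhi 1 0 8 1 = -5 ∧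
      rademacherPhi 1 0 12 1 = -9 ∧ rademacherPhi 1 0 24 1 = -21 := by
  obtain ⟨h1, h2, h3, h4, h6, h8, h12, h24⟩ := dedekindSum_one_values
  refine ⟨?_, ?_, ?_, ?_, ?_, ?_, ?_, ?_⟩
  · rw [rademacherPhi_of_c_ne_zero (by norm_num), Int.sign_eq_one_of_pos (by norm_num),
      show (1 : ℤ).natAbs = 1 from rfl, h1]; norm_num
  · rw [rademacherPhi_of_c_ne_zero (by norm_num), Int.sign_eq_one_of_pos (by norm_num),
      show (2 : ℤ).natAbs = 2 from rfl, h2]; norm_num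
  · rw [rademacherPhi_of_c_ne_zero (by norm_num), Int.sign_eq_one_of_pos (by norm_num),
      show (3 : ℤ).natAbs = 3 from rfl, h3]; norm_num
  · rw [rademacherPhi_of_c_ne_zero (by norm_num), Int.sign_eq_one_of_pos (by norm_num),
      show (4 : ℤ).natAbs = 4 from rfl, h4]; norm_num
  · rw [rademacherPhi_of_c_ne_zero (by norm_num), Int.sign_eq_one_of_pos (by norm_num),
      show (6 : ℤ).natAbs = 6 from rfl, h6]; norm_num
  · rw [rademacherPhi_of_c_ne_zero (by norm_num), Int.sign_eq_one_of_pos (by norm_num),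
      show (8 : ℤ).natAbs = 8 from rfl, h8]; norm_num
  · rw [rademacherPhi_of_c_ne_zero (by norm_num), Int.sign_eq_one_of_pos (by norm_num),
      show (12 : ℤ).natAbs = 12 from rfl, h12]; norm_num
  · rw [rademacherPhi_of_c_ne_zero (by norm_num), Int.sign_eq_one_of_pos (by norm_num),
      show (24 : ℤ).natAbs = 24 from rfl, h24]; norm_num

/-- `f ∣[k] (mapGL ℝ γ) = f ∣[k] γ` for `γ ∈ SL₂(ℤ)` (the two slash actions agree definitionally). [folklore] -/
theorem slash_mapGL (f : ℍ → ℂ) (k : ℤ) (γ : SL(2, ℤ)) :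
    f ∣[k] (Matrix.SpecialLinearGroup.mapGL ℝ γ : GL (Fin 2) ℝ) = f ∣[k] γ := rfl

/-- **Transformation of a weight-`0` `η`-quotient of level `24` under `W = (1 0; 24 1)`**:
`g(Wτ) = exp(−(πi/12) Σ_δ (24/δ) r_δ) · g(τ)` — Dedekind's functional equation factor by factor
(tree `etaQuotient_smul_eq_cexp_sum_rademacherPhi`) with `Φ(1, 0; 24/δ, 1) = 3 − 24/δ` and `Σ r_δ = 0`.
[cite: Apostol1990, Thm. 3.4] [cite: RademacherGrosswald1972, Ch. 4 A, eq. (60)] -/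
theorem etaQuotient24_smul_W (r : ℕ → ℤ) (hsum : ∑ t ∈ Nat.divisors 24, r t = 0) (W : SL(2, ℤ))
    (h00 : W 0 0 = 1) (h01 : W 0 1 = 0) (h10 : W 1 0 = 24) (h11 : W 1 1 = 1) (τ : ℍ) :
    etaQuotient 24 r (W • τ)
      = cexp (-(π * I / 12 * ((∑ t ∈ Nat.divisors 24, ((24 / t : ℕ) : ℤ) * r t : ℤ) : ℂ))) * etaQuotient 24 r τ := by
  have h := etaQuotient_smul_eq_cexp_sum_rademacherPhi 24 r hsum W (by rw [h10]; norm_num) (by rw [h10]; norm_num) τ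
  rw [h, h00, h01, h10, h11]
  congr 2
  obtain ⟨p1, p2, p3, p4, p6, p8, p12, p24⟩ := rademacherPhi_lower_values
  rw [show Nat.divisors 24 = {1, 2, 3, 4, 6, 8, 12, 24} by decide]
  rw [Finset.sum_insert (by decide), Finset.sum_insert (by decide), Finset.sum_insert (by decide),
    Finset.sum_insert (by decide), Finset.sum_insert (by decide), Finset.sum_insert (by decide),
    Finset.sum_insert (by decide), Finset.sum_singleton,
    Finset.sum_insert (by decide), Finset.sum_insert (by decide), Finset.sum_insert (by decide),
    Finset.sum_insert (by decide), Finset.sum_insert (by decide), Finset.sum_insert (by decide),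
    Finset.sum_insert (by decide), Finset.sum_singleton]
  simp only [zero_mul]
  norm_num
  rw [p1, p2, p3, p4, p6, p8, p12, p24]
  push_cast
  ring

/-- **`u∘W = −u`** for `u = φ₄₈/f₂₄ = η₄³η₁₂³/(η₂²η₆²η₈η₂₄)` (weight `0`, log period `½` along `W = (1 0; 24 1)`).
[cite: Apostol1990, Thm. 3.4] -/
theorem u_smul_W (W : SL(2, ℤ)) (h00 : W 0 0 = 1) (h01 : W 0 1 = 0) (h10 : W 1 0 = 24) (h11 : W 1 1 = 1) (τ : ℍ) :
    etaQuotient 24 (expFn [(2, -2), (4, 3), (6, -2), (8, -1), (12, 3), (24, -1)]) (W • τ)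
      = -etaQuotient 24 (expFn [(2, -2), (4, 3), (6, -2), (8, -1), (12, 3), (24, -1)]) τ := by
  rw [etaQuotient24_smul_W _ (by decide) W h00 h01 h10 h11 τ]
  have hs : (∑ t ∈ Nat.divisors 24, ((24 / t : ℕ) : ℤ) * expFn [(2, -2), (4, 3), (6, -2), (8, -1), (12, 3), (24, -1)] t
      : ℤ) = -12 := by decide
  rw [hs, show (-(π * I / 12 * ((-12 : ℤ) : ℂ)) : ℂ) = π * I by push_cast; ring, Complex.exp_pi_mul_I]
  ring

/-- The exponents of `φ₄₈` at the divisors of `48`. [folklore] -/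
theorem expFn_phi48_values :
    expFn [(2, -1), (4, 4), (6, -1), (8, -1), (12, 4), (24, -1)] 1 = 0 ∧
    expFn [(2, -1), (4, 4), (6, -1), (8, -1), (12, 4), (24, -1)] 2 = -1 ∧
    expFn [(2, -1), (4, 4), (6, -1), (8, -1), (12, 4), (24, -1)] 3 = 0 ∧
    expFn [(2, -1), (4, 4), (6, -1), (8, -1), (12, 4), (24, -1)] 4 = 4 ∧
    expFn [(2, -1), (4, 4), (6, -1), (8, -1), (12, 4), (24, -1)] 6 = -1 ∧
    expFn [(2, -1), (4, 4), (6, -1), (8, -1), (12, 4), (24, -1)] 8 = -1 ∧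
    expFn [(2, -1), (4, 4), (6, -1), (8, -1), (12, 4), (24, -1)] 12 = 4 ∧
    expFn [(2, -1), (4, 4), (6, -1), (8, -1), (12, 4), (24, -1)] 16 = 0 ∧
    expFn [(2, -1), (4, 4), (6, -1), (8, -1), (12, 4), (24, -1)] 24 = -1 ∧
    expFn [(2, -1), (4, 4), (6, -1), (8, -1), (12, 4), (24, -1)] 48 = 0 := by
  decide

/-- The exponents of `u = φ₄₈/f₂₄` at the divisors of `24`. [folklore] -/
theorem expFn_u_values :
    expFn [(2, -2), (4, 3), (6, -2), (8, -1), (12, 3), (24, -1)] 1 = 0 ∧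
    expFn [(2, -2), (4, 3), (6, -2), (8, -1), (12, 3), (24, -1)] 2 = -2 ∧
    expFn [(2, -2), (4, 3), (6, -2), (8, -1), (12, 3), (24, -1)] 3 = 0 ∧
    expFn [(2, -2), (4, 3), (6, -2), (8, -1), (12, 3), (24, -1)] 4 = 3 ∧
    expFn [(2, -2), (4, 3), (6, -2), (8, -1), (12, 3), (24, -1)] 6 = -2 ∧
    expFn [(2, -2), (4, 3), (6, -2), (8, -1), (12, 3), (24, -1)] 8 = -1 ∧
    expFn [(2, -2), (4, 3), (6, -2), (8, -1), (12, 3), (24, -1)] 12 = 3 ∧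
    expFn [(2, -2), (4, 3), (6, -2), (8, -1), (12, 3), (24, -1)] 24 = -1 := by
  decide

/-- The exponents of `f₂₄ = η₂η₄η₆η₁₂` at the divisors of `24`. [folklore] -/
theorem expFn_etaList24_values :
    expFn etaList24 1 = 0 ∧ expFn etaList24 2 = 1 ∧ expFn etaList24 3 = 0 ∧ expFn etaList24 4 = 1 ∧
    expFn etaList24 6 = 1 ∧ expFn etaList24 8 = 0 ∧ expFn etaList24 12 = 1 ∧ expFn etaList24 24 = 0 := by
  decide

/-- **`φ₄₈ = u · f₂₄`** pointwise (`η`-exponent bookkeeping: `(−1,4,−1,−1,4,−1) = (−2,3,−2,−1,3,−1) + (1,1,1,0,1,0)` on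
`δ = 2,4,6,8,12,24`). [folklore] -/
theorem phi48_eq_u_mul_eta24 (τ : ℍ) :
    etaQuotient 48 (expFn [(2, -1), (4, 4), (6, -1), (8, -1), (12, 4), (24, -1)]) τ
      = etaQuotient 24 (expFn [(2, -2), (4, 3), (6, -2), (8, -1), (12, 3), (24, -1)]) τ * cuspFormEta24 τ := by
  obtain ⟨a1, a2, a3, a4, a6, a8, a12, a16, a24, a48⟩ := expFn_phi48_values
  obtain ⟨b1, b2, b3, b4, b6, b8, b12, b24⟩ := expFn_u_values
  obtain ⟨c1, c2, c3, c4, c6, c8, c12, c24⟩ := expFn_etaList24_values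
  rw [show (cuspFormEta24 τ : ℂ) = etaQuotient 24 (expFn etaList24) τ from rfl,
    etaQuotient_apply, etaQuotient_apply, etaQuotient_apply,
    show Nat.divisors 48 = {1, 2, 3, 4, 6, 8, 12, 16, 24, 48} by decide,
    show Nat.divisors 24 = {1, 2, 3, 4, 6, 8, 12, 24} by decide]
  rw [Finset.prod_insert (by decide), Finset.prod_insert (by decide), Finset.prod_insert (by decide),
    Finset.prod_insert (by decide), Finset.prod_insert (by decide), Finset.prod_insert (by decide),
    Finset.prod_insert (by decide), Finset.prod_insert (by decide), Finset.prod_insert (by decide),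
    Finset.prod_singleton,
    Finset.prod_insert (by decide), Finset.prod_insert (by decide), Finset.prod_insert (by decide),
    Finset.prod_insert (by decide), Finset.prod_insert (by decide), Finset.prod_insert (by decide),
    Finset.prod_insert (by decide), Finset.prod_singleton,
    Finset.prod_insert (by decide), Finset.prod_insert (by decide), Finset.prod_insert (by decide),
    Finset.prod_insert (by decide), Finset.prod_insert (by decide), Finset.prod_insert (by decide),
    Finset.prod_insert (by decide), Finset.prod_singleton]
  rw [a1, a2, a3, a4, a6, a8, a12, a16, a24, a48, b1, b2, b3, b4, b6, b8, b12, b24, c1, c2, c3, c4, c6, c8, c12, c24]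
  have h2 := eta_natMul_ne_zero (by norm_num : 0 < 2) τ.im_pos
  have h4 := eta_natMul_ne_zero (by norm_num : 0 < 4) τ.im_pos
  have h6 := eta_natMul_ne_zero (by norm_num : 0 < 6) τ.im_pos
  have h8 := eta_natMul_ne_zero (by norm_num : 0 < 8) τ.im_pos
  have h12 := eta_natMul_ne_zero (by norm_num : 0 < 12) τ.im_pos
  have h24 := eta_natMul_ne_zero (by norm_num : 0 < 24) τ.im_pos
  simp only [zpow_neg, zpow_ofNat]
  field_simp

/-- `W = (1 0; 24 1)` lies in `Γ₀(24)`. [folklore] -/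
theorem mem_Gamma0_twentyFour_of_entries (W : SL(2, ℤ)) (h10 : W 1 0 = 24) : W ∈ Gamma0 24 := by
  rw [Gamma0_mem, h10]
  decide

/-- **`φ₄₈(Wτ) = −(24τ + 1)² φ₄₈(τ)`** for `W = (1 0; 24 1) ∈ Γ₀(24) ∖ Γ₀(48)` (`u∘W = −u`, `f₂₄|W = f₂₄`). [cite: Apostol1990, Thm. 3.4] -/
theorem phi48_smul_W (W : SL(2, ℤ)) (h00 : W 0 0 = 1) (h01 : W 0 1 = 0) (h10 : W 1 0 = 24) (h11 : W 1 1 = 1)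
    (τ : ℍ) :
    etaQuotient 48 (expFn [(2, -1), (4, 4), (6, -1), (8, -1), (12, 4), (24, -1)]) (W • τ)
      = -((24 * (τ : ℂ) + 1) ^ 2
          * etaQuotient 48 (expFn [(2, -1), (4, 4), (6, -1), (8, -1), (12, 4), (24, -1)]) τ) := by
  have hf : cuspFormEta24 (W • τ) = (24 * (τ : ℂ) + 1) ^ 2 * cuspFormEta24 τ := by
    have h := SlashInvariantForm.slash_action_eqn cuspFormEta24 _ ⟨W, mem_Gamma0_twentyFour_of_entries W h10, rfl⟩
    have h' := congr_fun h τ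
    rw [slash_mapGL, SL_slash_apply, ModularGroup.denom_apply, h10, h11] at h'
    push_cast at h'
    have hne : (24 * (τ : ℂ) + 1) ≠ 0 := by
      have h2 := SL2_denom_ne_zero W τ
      rw [h10, h11] at h2
      push_cast at h2
      exact h2
    rw [← h']
    field_simp
  rw [phi48_eq_u_mul_eta24, phi48_eq_u_mul_eta24, u_smul_W W h00 h01 h10 h11, hf]
  ring

/-- **`φ₄₈|₂W = −φ₄₈`.** [cite: Apostol1990, Thm. 3.4] -/
theorem phi48_slash_W (W : SL(2, ℤ)) (h00 : W 0 0 = 1) (h01 : W 0 1 = 0) (h10 : W 1 0 = 24) (h11 : W 1 1 = 1)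
    (τ : ℍ) :
    (etaQuotient 48 (expFn [(2, -1), (4, 4), (6, -1), (8, -1), (12, 4), (24, -1)]) ∣[(2 : ℤ)] W) τ
      = -etaQuotient 48 (expFn [(2, -1), (4, 4), (6, -1), (8, -1), (12, 4), (24, -1)]) τ := by
  rw [SL_slash_apply, ModularGroup.denom_apply, h10, h11, phi48_smul_W W h00 h01 h10 h11]
  push_cast
  have hne : (24 * (τ : ℂ) + 1) ≠ 0 := by
    have h2 := SL2_denom_ne_zero W τ
    rw [h10, h11] at h2
    push_cast at h2
    exact h2
  field_simp

/-- **The trace `S₂(Γ₀(48)) → S₂(Γ₀(24))` kills `φ₄₈`**: `adjDegeneracyMap0 48 24 1 2 φ₄₈ = φ₄₈ + φ₄₈|W = 0`, `W = ᵀ(T²⁴)`.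
[cite: DiamondShurman2005, §5.1 special case (3)] -/
theorem adjDegeneracyMap0_one_phi48 (φ : CuspForm (Gamma0 48) 2)
    (hφ : ⇑φ = etaQuotient 48 (expFn [(2, -1), (4, 4), (6, -1), (8, -1), (12, 4), (24, -1)])) :
    adjDegeneracyMap0 48 24 1 2 φ = 0 := by
  haveI : Fact (Nat.Prime 2) := ⟨Nat.prime_two⟩
  have h := coe_adjDegeneracyMap0_one_eq_sum 2 2 24 48 (by norm_num) (by norm_num) φ
  apply DFunLike.ext
  intro τ
  have hτ := congr_fun h τ
  rw [Finset.sum_apply, Fin.sum_univ_two] at hτ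
  rw [CuspForm.zero_apply, hτ]
  have h0 : (Matrix.SpecialLinearGroup.transpose (ModularGroup.T ^ ((24 : ℕ) * (((0 : Fin 2) : ℕ) : ℤ) : ℤ))
      : SL(2, ℤ)) = 1 := by
    ext i j
    fin_cases i <;> fin_cases j <;>
      simp [Matrix.SpecialLinearGroup.transpose]
  set X : SL(2, ℤ) := Matrix.SpecialLinearGroup.transpose (ModularGroup.T ^ ((24 : ℕ) * (((1 : Fin 2) : ℕ) : ℤ) : ℤ))
    with hX
  have hX' : ∀ i j : Fin 2, X i j = !![(1 : ℤ), 0; 24, 1] i j := by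
    intro i j
    rw [hX]
    fin_cases i <;> fin_cases j <;>
      simp [Matrix.SpecialLinearGroup.transpose, ModularGroup.coe_T_zpow]
  rw [h0, map_one, SlashAction.slash_one, slash_mapGL, hφ,
    phi48_slash_W X (by simpa using hX' 0 0) (by simpa using hX' 0 1) (by simpa using hX' 1 0)
      (by simpa using hX' 1 1)]
  ring

end Summit.BirchSwinnertonDyer.BirchSwinnertonDyer.Theorems.ManinLocalTwoThree.NewformFortyEight

end
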